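import Summits.QuantumFields.QCD.Theses.PauliWegnerSea
import Summits.QuantumFields.QCD.Theorems.GluonicCompletion.Negative.Threshold

/-!
# drefute lemmas for line `certified-sea-threshold-graft` (crux stmt-QuantumFields-9152)

refuter-drefute-stmt-QuantumFields-9152-0, 2026-08-16. Sorry-free, standard axioms; `lean check` rc 0.
Self-contained: `Body` and `subseqReg` below are VERBATIM copies of the skeleton's
(`Cruxes/GluonicCompletion/Lines/certified-sea-threshold-graft.lean`, §0) — delete them when pasting the
lemmas into the lead's work file (same namespace).

Contents (evidence for the lead, NOT a Theorems proposal — positive lemmas travel as item evidence):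
* `qcdLatticeSchwinger_subseqReg`, `qcdLatticeSchwinger_subseqReg_comp` — the `rfl` reading of the lattice
  Schwinger functions along a subsequence regularisation (ingredient (a)/(b) of `stub_diagonal`);
* `body_subseqReg`, `subseqReg_subseqReg`, `body_subseqReg_comp` — heredity of `Body` under subsequences;
* `body_congr_eventuallyEq`, `body_of_eventually_subseq` — insensitivity of `Body` to finitely many initial
  terms of the index sequence: `Φ =ᶠ Ψ ∘ θ` and `Body` along `Ψ` give `Body` along `Φ` (the diagonal step);
* `N_f = 0` sanity instances of the flavour-unrestricted stubs (`cutoffWindowAt_zero`, `largeMassRateAt_zero`,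
  `quarkLocalityAt_zero`, `diagonal_zero`): no degenerate-flavour counterexample hides in their `∀ Nf`.
-/

namespace Summit.QuantumFields.QCD.Cruxes.GluonicCompletion.CertifiedSeaThresholdGraft

open scoped BigOperators
open MeasureTheory Filter Literature.MathematicalPhysics.QuantumFieldTheory
  Literature.MathematicalPhysics.QuantumLattice Literature.Probability.LatticeModels

noncomputable section

/-! ### Verbatim copies from the skeleton (§0) — delete when pasting -/

/-- VERBATIM `Body` of the skeleton. -/
def Body (Nf : ℕ) (reg : QCDRegularisation Nf) (m : Fin Nf → ℝ) : Prop :=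
  ∃ (z shift : QCDField Nf → ℕ → ℝ) (T : OSData (QCDField Nf) 4),
    IsQCDAlong (reg.scheme m z shift) T ∧ T.IsNontrivial QCDField.glue ∧ T.IsNonGaussian QCDField.glue ∧
      (∀ f g : Fin Nf, f ≠ g → T.IsNontrivial (QCDField.pseudoRe f g)) ∧
        ∃ Δ > 0, T.HasMassGap Δ ∧ (reg.scheme m z shift).HasLatticeMassGap Δ

/-- VERBATIM `subseqReg` of the skeleton. -/
def subseqReg {Nf : ℕ} (reg : QCDRegularisation Nf) (φ : ℕ → ℕ) (hφ : StrictMono φ) :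
    QCDRegularisation Nf where
  a k := reg.a (φ k)
  a_pos k := reg.a_pos (φ k)
  tendsto_a := reg.tendsto_a.comp hφ.tendsto_atTop
  β k := reg.β (φ k)
  L k := reg.L (φ k)
  tendsto_L := reg.tendsto_L.comp hφ.tendsto_atTop
  mcrit k := reg.mcrit (φ k)
  Zm k := reg.Zm (φ k)
  Zm_pos k := reg.Zm_pos (φ k)

/-! ### The lemmas -/

variable {Nf : ℕ}

/-- Along the subsequence regularisation the `k`-th lattice Schwinger function IS the base
regularisation's `φ k`-th one (species renormalisations frozen at their `k`-th values). -/
theorem qcdLatticeSchwinger_subseqReg (reg : QCDRegularisation Nf) (φ : ℕ → ℕ)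
    (hφ : StrictMono φ) (m : Fin Nf → ℝ) (z shift : QCDField Nf → ℕ → ℝ) (k n : ℕ)
    (σ : Fin n → QCDField Nf) (f : Fin n → SchwartzMap (EuclideanSpace ℝ (Fin 4)) ℝ) :
    qcdLatticeSchwinger ((subseqReg reg φ hφ).scheme m z shift) k n σ f =
      qcdLatticeSchwinger (reg.scheme m (fun s _ => z s k) (fun s _ => shift s k)) (φ k) n σ f :=
  rfl

/-- The same with the renormalisations read along `φ`. -/
theorem qcdLatticeSchwinger_subseqReg_comp (reg : QCDRegularisation Nf) (φ : ℕ → ℕ)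
    (hφ : StrictMono φ) (m : Fin Nf → ℝ) (z shift : QCDField Nf → ℕ → ℝ) (k n : ℕ)
    (σ : Fin n → QCDField Nf) (f : Fin n → SchwartzMap (EuclideanSpace ℝ (Fin 4)) ℝ) :
    qcdLatticeSchwinger ((subseqReg reg φ hφ).scheme m (fun s k => z s (φ k)) (fun s k => shift s (φ k)))
        k n σ f =
      qcdLatticeSchwinger (reg.scheme m z shift) (φ k) n σ f :=
  rfl

/-- **Heredity of `Body` under subsequences**: reindex `z, shift`, keep `T` and `Δ`. -/
theorem body_subseqReg (reg : QCDRegularisation Nf) (φ : ℕ → ℕ) (hφ : StrictMono φ)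
    (m : Fin Nf → ℝ) (h : Body Nf reg m) : Body Nf (subseqReg reg φ hφ) m := by
  obtain ⟨z, shift, T, hQ, h1, h2, h3, Δ, hΔ, hT, hL⟩ := h
  refine ⟨fun s k => z s (φ k), fun s k => shift s (φ k), T, ?_, h1, h2, h3, Δ, hΔ, hT, ?_⟩
  · obtain ⟨hAS, hmq, hconv⟩ := hQ
    refine ⟨?_, fun fl => hφ.tendsto_atTop.eventually (hmq fl), fun n hn σ f F hF hoff => ?_⟩
    · obtain ⟨Λ, hΛ, ht⟩ := hAS
      exact ⟨Λ, hΛ, ht.comp hφ.tendsto_atTop⟩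
    · have := (hconv n hn σ f F hF hoff).comp hφ.tendsto_atTop
      refine this.congr' (Eventually.of_forall fun k => ?_)
      exact (qcdLatticeSchwinger_subseqReg_comp reg φ hφ m z shift k n σ f).symm
  · intro R R' A B
    obtain ⟨C, hC⟩ := hL R R' A B
    exact ⟨C, hφ.tendsto_atTop.eventually hC⟩

/-- Nested subsequences are one subsequence, definitionally. -/
theorem subseqReg_subseqReg (reg : QCDRegularisation Nf) (ψ : ℕ → ℕ) (hψ : StrictMono ψ)
    (φ : ℕ → ℕ) (hφ : StrictMono φ) :
    subseqReg (subseqReg reg ψ hψ) φ hφ = subseqReg reg (ψ ∘ φ) (hψ.comp hφ) :=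
  rfl

/-- `Body` along `reg ∘ ψ` passes to `reg ∘ ψ ∘ φ`. -/
theorem body_subseqReg_comp (reg : QCDRegularisation Nf) (ψ : ℕ → ℕ) (hψ : StrictMono ψ)
    (φ : ℕ → ℕ) (hφ : StrictMono φ) (m : Fin Nf → ℝ) (h : Body Nf (subseqReg reg ψ hψ) m) :
    Body Nf (subseqReg reg (ψ ∘ φ) (hψ.comp hφ)) m :=
  body_subseqReg (subseqReg reg ψ hψ) φ hφ m h

/-- **Insensitivity of `Body` to finitely many initial terms of the index sequence**: two strictly
increasing index sequences that agree eventually carry the same `Body` (every clause is a `Tendsto`/`∀ᶠ`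
statement in `k` reading the regularisation only through its `k`-th datum). -/
theorem body_congr_eventuallyEq (reg : QCDRegularisation Nf) (Φ Ψ : ℕ → ℕ) (hΦ : StrictMono Φ)
    (hΨ : StrictMono Ψ) (heq : ∀ᶠ j in atTop, Φ j = Ψ j) (m : Fin Nf → ℝ)
    (h : Body Nf (subseqReg reg Ψ hΨ) m) : Body Nf (subseqReg reg Φ hΦ) m := by
  obtain ⟨z, shift, T, ⟨hAS, hmq, hconv⟩, h1, h2, h3, Δ, hΔ, hT, hL⟩ := h
  refine ⟨z, shift, T, ⟨?_, fun fl => ?_, fun n hn σ f F hF hoff => ?_⟩, h1, h2, h3, Δ, hΔ, hT, ?_⟩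
  · obtain ⟨Λ, hΛ, ht⟩ := hAS
    refine ⟨Λ, hΛ, ht.congr' (heq.mono fun j hj => ?_)⟩
    show reg.β (Ψ j) - afBeta Nf Λ (reg.a (Ψ j)) = reg.β (Φ j) - afBeta Nf Λ (reg.a (Φ j))
    rw [hj]
  · filter_upwards [hmq fl, heq] with j h hj
    show -1 < reg.mcrit (Φ j) + reg.a (Φ j) * m fl / reg.Zm (Φ j)
    rw [hj]; exact h
  · refine (hconv n hn σ f F hF hoff).congr' (heq.mono fun j hj => ?_)
    show qcdLatticeSchwinger ((subseqReg reg Ψ hΨ).scheme m z shift) j n σ f =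
      qcdLatticeSchwinger ((subseqReg reg Φ hΦ).scheme m z shift) j n σ f
    rw [qcdLatticeSchwinger_subseqReg, qcdLatticeSchwinger_subseqReg, hj]
  · intro R R' A B
    obtain ⟨C, hC⟩ := hL R R' A B
    refine ⟨C, ?_⟩
    filter_upwards [hC, heq] with j h hj
    show ∀ S : ℕ, reg.L (Φ j) ≤ S → ∀ n : ℕ, n ≤ S →
      ‖qcdLatticeConnectedCorr (reg.β (Φ j)) (2 * S + 1)
          (fun fl => reg.mcrit (Φ j) + reg.a (Φ j) * m fl / reg.Zm (Φ j)) A B n‖ ≤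
        C * Real.exp (-(Δ * (reg.a (Φ j) * n)))
    rw [hj]; exact h

/-- **The diagonal step** in the form `stub_diagonal` needs: `Body` along `Ψ` and `Φ =ᶠ Ψ ∘ θ`
(`θ` strictly increasing) give `Body` along `Φ`. -/
theorem body_of_eventually_subseq (reg : QCDRegularisation Nf) (Φ Ψ θ : ℕ → ℕ) (hΦ : StrictMono Φ)
    (hΨ : StrictMono Ψ) (hθ : StrictMono θ) (heq : ∀ᶠ j in atTop, Φ j = Ψ (θ j)) (m : Fin Nf → ℝ)
    (h : Body Nf (subseqReg reg Ψ hΨ) m) : Body Nf (subseqReg reg Φ hΦ) m :=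
  body_congr_eventuallyEq reg Φ (Ψ ∘ θ) hΦ (hΨ.comp hθ) heq m (body_subseqReg_comp reg Ψ hΨ θ hθ m h)

/-- `stub_diagonal` at `N_f = 0`: the mass space is one point, take `ψ = id`. -/
theorem diagonal_zero (reg : QCDRegularisation 0) (M₁ : ℝ)
    (h : ∀ m₀ : Fin 0 → ℝ, (∀ f, M₁ < m₀ f) → ∃ ε : ℝ, 0 < ε ∧
      ∀ (ψ : ℕ → ℕ) (hψ : StrictMono ψ), ∃ (φ : ℕ → ℕ) (hφ : StrictMono φ),
        ∀ m : Fin 0 → ℝ, (∀ f, M₁ < m f) → (∀ f, |m f - m₀ f| < ε) →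
          Body 0 (subseqReg (subseqReg reg ψ hψ) φ hφ) m) :
    ∃ (φ : ℕ → ℕ) (hφ : StrictMono φ), ∀ m : Fin 0 → ℝ, (∀ f, M₁ < m f) →
      Body 0 (subseqReg reg φ hφ) m := by
  obtain ⟨ε, hε, hall⟩ := h Fin.elim0 (fun f => f.elim0)
  obtain ⟨φ, hφ, hb⟩ := hall id strictMono_id
  refine ⟨φ, hφ, fun m _ => ?_⟩
  have hm : m = Fin.elim0 := funext fun f => f.elim0
  subst hm
  exact hb _ (fun f => f.elim0) (fun f => f.elim0)

end

end Summit.QuantumFields.QCD.Cruxes.GluonicCompletion.CertifiedSeaThresholdGraft
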